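import Mathlib
import Summits.Ventures.PercRepro2.Defs
import Summits.Ventures.PercRepro2.Independence
import Summits.Ventures.PercRepro2.Harris
import Summits.Ventures.PercRepro2.Graph
import Summits.Ventures.PercRepro2.Exploration
import Summits.Ventures.PercRepro2.Events
import Summits.Ventures.PercRepro2.FourFunctions
import Summits.Ventures.PercRepro2.Induced
import Summits.Ventures.PercRepro2.Frontier
import Summits.Ventures.PercRepro2.ObsIndependence
import Summits.Ventures.PercRepro2.BHK
import Summits.Ventures.PercRepro2.BHKEvents
import Summits.Ventures.PercRepro2.VdBKahn

/-!
# The cross-cluster inequality with set avoidance (blind cell PercRepro2, p1)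

BHK06 Thm 1.4 for events with a set `X ∋ t` avoided by the root `s`:
`P(C_s ∈ 𝓤, C_t ∈ 𝓥, s ↮ X) · P(s ↮ X) ≤ P(C_s ∈ 𝓤, s ↮ X) · P(C_t ∈ 𝓥, s ↮ X)`
(`bhk_cross_cluster_avoid`; `X = {t}` is `bhk_cross_cluster`). Same proof: explore `C_s`, on
`{s ↮ X}` the cluster of `t` is its cluster in `G ∖ C_s`, tower identity, then the functional
same-cluster inequality `bhk_induced` with `X = Y` and `F₂ = 1 − g`.
-/

namespace Summit.Ventures.PercRepro2

section CrossAvoid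

variable {V : Type*} {E : Type*} [Fintype E] [DecidableEq E] [Fintype V] [DecidableEq V]
  {R : Type*} [CommRing R] [LinearOrder R] [IsStrictOrderedRing R]

omit [Fintype E] [DecidableEq E] [Fintype V] [DecidableEq V] in
/-- Membership in `avoidAll`. -/
lemma mem_avoidAll {ends : E → Sym2 V} {s : V} {X : Finset V} {ω : Config E} :
    ω ∈ avoidAll ends s X ↔ ∀ x ∈ X, ¬ Conn ends ω s x := Iff.rfl

omit [Fintype E] [DecidableEq E] [Fintype V] [DecidableEq V] in
/-- On `{s ↮ X}` with `t ∈ X`, `t ∉ C_s`. -/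
lemma notMem_cluster_of_mem_avoidAll {ends : E → Sym2 V} {s t : V} {X : Finset V} (ht : t ∈ X)
    {ω : Config E} (h : ω ∈ avoidAll ends s X) : t ∉ cluster ends ω s :=
  fun hc => h t ht hc

omit [DecidableEq V] [LinearOrder R] [IsStrictOrderedRing R] in
/-- **Exploring the cluster of `s` under set avoidance**: for `t ∈ X`,
`P(C_s ∈ 𝓤, C_t ∈ 𝓥, s ↮ X) = E[1_𝓤(C_s) · g(C_s) · 1_{s↮X}]` with `g = delClusterProb`. -/
theorem prob_clusterIn_inter_avoid_eq_expect (p : E → R) (ends : E → Sym2 V) (s t : V)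
    {X : Finset V} (ht : t ∈ X) (𝓤 𝓥 : Set (Set V)) :
    prob p (clusterInEvent ends s 𝓤 ∩ clusterInEvent ends t 𝓥 ∩ avoidAll ends s X) =
      expect p (fun ω => 𝓤.indicator 1 (cluster ends ω s) *
        delClusterProb p ends t 𝓥 (cluster ends ω s) * (avoidAll ends s X).indicator 1 ω) := by
  classical
  -- `𝓐 = {W | W ∩ X = ∅}` describes `{s ↮ X}` through the cluster of `s`
  let 𝓐 : Set (Set V) := {W | ∀ x ∈ X, x ∉ W}
  have hA : ∀ ω, ω ∈ avoidAll ends s X ↔ cluster ends ω s ∈ 𝓐 := fun ω => Iff.rfl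
  let c : Set V → R := fun W => 𝓤.indicator 1 W * 𝓐.indicator 1 W
  let D : Set V → Config E → R := fun W =>
    ({ω | cluster ends (delConfig ends W ω) t ∈ 𝓥} : Set (Config E)).indicator 1
  let Φ : Set V → Config E → R := fun W ω => c W * D W ω
  have hΦ : ∀ W, DependsOn (Φ W) (touches ends W)ᶜ := by
    intro W ω ω' h
    simp only [Φ, D]
    congr 1
    refine dependsOn_indicator (R := R) (fun ω ω' h => ?_) h
    show (cluster ends (delConfig ends W ω) t ∈ 𝓥) = (cluster ends (delConfig ends W ω') t ∈ 𝓥)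
    rw [delConfig_congr h]
  have hS : ∀ W : Set V, DependsOn (· ∈ {ω | cluster ends ω s = W}) (touches ends W) :=
    fun W => dependsOn_clusterEvent ends s W
  have hdisj : ∀ W : Set V, Disjoint (touches ends W) (touches ends W)ᶜ :=
    fun W => disjoint_compl_right
  have hpt : ∀ ω, (clusterInEvent ends s 𝓤 ∩ clusterInEvent ends t 𝓥 ∩
      avoidAll ends s X).indicator (1 : Config E → R) ω = Φ (cluster ends ω s) ω := by
    intro ω
    simp only [Φ, c, D]
    by_cases hav : ω ∈ avoidAll ends s X
    · have hst : t ∉ cluster ends ω s := notMem_cluster_of_mem_avoidAll ht hav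
      have e := cluster_delConfig_cluster (ends := ends) (ω := ω) (s := s) hst
      have hmem : ω ∈ {ω' | cluster ends (delConfig ends (cluster ends ω s) ω') t ∈ 𝓥} ↔
          cluster ends ω t ∈ 𝓥 := by
        rw [Set.mem_setOf_eq, e]
      rw [Set.indicator_of_mem (show cluster ends ω s ∈ 𝓐 from (hA ω).1 hav)]
      by_cases h𝓤 : cluster ends ω s ∈ 𝓤
      · rw [Set.indicator_of_mem h𝓤]
        by_cases h𝓥 : cluster ends ω t ∈ 𝓥
        · rw [Set.indicator_of_mem (show ω ∈ clusterInEvent ends s 𝓤 ∩ clusterInEvent ends t 𝓥 ∩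
              avoidAll ends s X from ⟨⟨h𝓤, h𝓥⟩, hav⟩), Set.indicator_of_mem (hmem.2 h𝓥)]
          simp
        · rw [Set.indicator_of_notMem (show ω ∉ clusterInEvent ends s 𝓤 ∩ clusterInEvent ends t 𝓥 ∩
              avoidAll ends s X from fun h => h𝓥 h.1.2),
            Set.indicator_of_notMem (fun h => h𝓥 (hmem.1 h))]
          simp
      · rw [Set.indicator_of_notMem (show ω ∉ clusterInEvent ends s 𝓤 ∩ clusterInEvent ends t 𝓥 ∩
            avoidAll ends s X from fun h => h𝓤 h.1.1), Set.indicator_of_notMem h𝓤]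
        simp
    · rw [Set.indicator_of_notMem (show ω ∉ clusterInEvent ends s 𝓤 ∩ clusterInEvent ends t 𝓥 ∩
          avoidAll ends s X from fun h => hav h.2),
        Set.indicator_of_notMem (show cluster ends ω s ∉ 𝓐 from fun h => hav ((hA ω).2 h))]
      simp
  have hΦexp : ∀ W, expect p (Φ W) = c W * delClusterProb p ends t 𝓥 W := by
    intro W
    simp only [Φ, D]
    rw [expect_const_mul, ← prob_eq_expect_indicator]
    rfl
  rw [prob_eq_expect_indicator]
  have e1 : (clusterInEvent ends s 𝓤 ∩ clusterInEvent ends t 𝓥 ∩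
      avoidAll ends s X).indicator (1 : Config E → R) = fun ω => Φ (cluster ends ω s) ω :=
    funext hpt
  rw [e1, expect_tower p hdisj (S := fun ω => cluster ends ω s) hS hΦ]
  simp only [hΦexp]
  unfold expect
  refine Finset.sum_congr rfl fun ω _ => ?_
  simp only [c]
  by_cases hav : ω ∈ avoidAll ends s X
  · rw [Set.indicator_of_mem (show cluster ends ω s ∈ 𝓐 from (hA ω).1 hav),
      Set.indicator_of_mem hav]
    simp
  · rw [Set.indicator_of_notMem (show cluster ends ω s ∉ 𝓐 from fun h => hav ((hA ω).2 h)),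
      Set.indicator_of_notMem hav]
    simp

/-- **BHK, different clusters, with set avoidance** (BHK06 Thm 1.4, `X ∋ t` avoided): for up-sets
`𝓤, 𝓥`, `P(C_s ∈ 𝓤, C_t ∈ 𝓥, s↮X) · P(s↮X) ≤ P(C_s ∈ 𝓤, s↮X) · P(C_t ∈ 𝓥, s↮X)`. -/
theorem bhk_cross_cluster_avoid (p : E → R) (hp : IsProbVec p) (ends : E → Sym2 V) (s t : V)
    {X : Finset V} (ht : t ∈ X) {𝓤 𝓥 : Set (Set V)} (h𝓤 : IsUpperSet 𝓤) (h𝓥 : IsUpperSet 𝓥) :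
    prob p (clusterInEvent ends s 𝓤 ∩ clusterInEvent ends t 𝓥 ∩ avoidAll ends s X) *
        prob p (avoidAll ends s X) ≤
      prob p (clusterInEvent ends s 𝓤 ∩ avoidAll ends s X) *
        prob p (clusterInEvent ends t 𝓥 ∩ avoidAll ends s X) := by
  classical
  set g := delClusterProb p ends t 𝓥 with hg
  have hg_anti : Antitone g := delClusterProb_anti p hp ends t h𝓥
  have hg1 : ∀ W, g W ≤ 1 := delClusterProb_le_one p hp ends t 𝓥
  have eUV := prob_clusterIn_inter_avoid_eq_expect p ends s t ht 𝓤 𝓥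
  have eV := prob_clusterIn_inter_avoid_eq_expect p ends s t ht Set.univ 𝓥
  simp only [Set.indicator_univ, Pi.one_apply, one_mul] at eV
  have eV' : clusterInEvent ends s Set.univ ∩ clusterInEvent ends t 𝓥 ∩ avoidAll ends s X =
      clusterInEvent ends t 𝓥 ∩ avoidAll ends s X := by
    ext ω; simp [clusterInEvent]
  rw [eV'] at eV
  -- the functional same-cluster inequality with `X = Y`
  have hF₁ : Monotone (𝓤.indicator (1 : Set V → R)) := monotone_indicator_one_of_isUpperSet h𝓤
  have hF₂ : Monotone (fun W => 1 - g W) := fun W W' h => by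
    simp only
    linarith [hg_anti h]
  have hF₁0 : ∀ W, 0 ≤ 𝓤.indicator (1 : Set V → R) W :=
    fun W => Set.indicator_apply_nonneg fun _ => zero_le_one
  have hF₂0 : ∀ W, 0 ≤ 1 - g W := fun W => by linarith [hg1 W]
  have key := bhk_induced p hp ends s hF₁ hF₂ hF₁0 hF₂0 Finset.univ X X (Finset.subset_univ _)
    (Finset.subset_univ _)
  simp only [Finset.inter_self, Finset.union_self, REvent_univ] at key
  have e : ∀ F : Set V → R, clusterObs ends Finset.univ s F * (avoidAll ends s X).indicator 1 =
      fun ω => F (cluster ends ω s) * (avoidAll ends s X).indicator 1 ω := by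
    intro F
    funext ω
    simp only [Pi.mul_apply, clusterObs_apply, clusterIn_univ]
  rw [e, e, e] at key
  simp only [Pi.mul_apply] at key
  have eU : expect p (fun ω => 𝓤.indicator 1 (cluster ends ω s) *
      (avoidAll ends s X).indicator 1 ω) =
      prob p (clusterInEvent ends s 𝓤 ∩ avoidAll ends s X) :=
    (prob_clusterInEvent_inter_eq_expect p ends s 𝓤 _).symm
  have eR : prob p (avoidAll ends s X) =
      expect p fun ω => (avoidAll ends s X).indicator 1 ω := prob_eq_expect_indicator p _
  have e2 : expect p (fun ω => (1 - g (cluster ends ω s)) * (avoidAll ends s X).indicator 1 ω) =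
      prob p (avoidAll ends s X) - prob p (clusterInEvent ends t 𝓥 ∩ avoidAll ends s X) := by
    rw [eV, eR, ← expect_sub]
    congr 1
    funext ω
    simp only [Pi.sub_apply]
    ring
  have e3 : expect p (fun ω => 𝓤.indicator 1 (cluster ends ω s) * (1 - g (cluster ends ω s)) *
      (avoidAll ends s X).indicator 1 ω) =
      prob p (clusterInEvent ends s 𝓤 ∩ avoidAll ends s X) -
        prob p (clusterInEvent ends s 𝓤 ∩ clusterInEvent ends t 𝓥 ∩ avoidAll ends s X) := by
    rw [eUV, ← eU, ← expect_sub]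
    congr 1
    funext ω
    simp only [Pi.sub_apply]
    ring
  rw [eU, e2, e3] at key
  nlinarith [key]

end CrossAvoid

end Summit.Ventures.PercRepro2
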